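import Mathlib
import HarnessLib
import Literature.Analysis.ValidatedNumerics.IntervalLogArctan
import Summits.KontsevichZagierPeriods.Zeta5Search.Denom.TwoTaleP15LineCertificate
import Summits.KontsevichZagierPeriods.Zeta5Search.TwoTaleP15SecondLineProfileShape

/-!
# Two-point tangent certificate for the second-tale line profile at P15 (DecayT, one-variable side)

HONEST FRAMING: systematic search; no irrationality claim unless certified.  This file proves an
inequality about an explicit elementary function of one real variable; no statement about
`ζ(2)`, `ζ(5)` or any linear form is made here.

With `PT = profileT (−897/100)` and `DT = angleT (−897/100) − 2π`
(`TwoTaleP15SecondLineProfileShape.lean`), the two-point lemma `twoPoint` reduces `sup_{η>0} PT ≤ c` to three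
facts at two rational points.  They are certified at `η₁ = 12914/10000`, `η₂ = 12917/10000` by the tree's kernel
interval engine `Literature.Analysis.ValidatedNumerics` exactly as in fam-denom's `Denom/RungALineCertificate.lean`
(scale `sc = 2^56`, term counts `KL`, `KA`, `mem_zero` reused from `Denom/TwoTaleP15LineCertificate.lean`):
evaluators `legA100`/`legG100`/`sumA100`/`sumG100`/`constGT` for legs `p/100`, the Boolean test `certCheckT`
(`certCheckT_eq : certCheckT = true` by `decide +kernel`) and its soundness, giving

* `profileT_le : η ≠ 0 → profileT (−897/100) η ≤ −29.10786` (design supremum `−29.1078672…`, attained near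
  `η = 1.29150`), and the certificate WITH SLACK
* `certT_delta : 0 ≤ δ → δ ≤ 3 → η ≠ 0 → profileT0 (−897/100) η − (2π − δ)|η| ≤ −29.10786 + 7 δ`
  (concavity on `(0, 7]` and the tail slope `PT_tail`),

the one-variable input of the second-tale decay `DecayT c′` (fam-measure g5's U2 chain; the W1 closing
`TwoTaleP15CoincidenceW1` needs only `c′ ≥ 25.5`).  Nothing here is conjectural.
-/

noncomputable section

open Real Set

namespace Summit.KontsevichZagierPeriods.Zeta5Search.TwoTaleP15SecondLineCertificate

open Summit.KontsevichZagierPeriods.Zeta5Search.Denom.LineProfile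
open Summit.KontsevichZagierPeriods.Zeta5Search.TwoTaleP15SecondLineProfileShape
open Summit.KontsevichZagierPeriods.Zeta5Search.Denom.TwoTaleP15LineCertificate
  (sc sc_pos KL KA mem_zero)
open Literature.Analysis.ValidatedNumerics.NumericsMP

/-- Enclosure of the angle `arctan ((p/100)/η)`, given `E ∋ η` and `piI ∋ π`. -/
def legA100 (piI E : MI) (p : ℤ) : Option MI :=
  match MI.divPos sc (MI.ofFrac sc p 100) E with
  | some Q => MI.arctan sc KA piI Q
  | none => none

/-- Soundness of `legA100`. -/
theorem mem_legA100 {η : ℝ} {piI E : MI} (hpi : MI.mem sc Real.pi piI) (hE : MI.mem sc η E)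
    {p : ℤ} {A : MI} (h : legA100 piI E p = some A) :
    MI.mem sc (Real.arctan ((p : ℝ) / 100 / η)) A := by
  unfold legA100 at h
  split at h
  · rename_i Q hQ
    have hW : MI.mem sc ((p : ℝ) / 100) (MI.ofFrac sc p 100) := by
      simpa using MI.mem_ofFrac sc p (by norm_num : 0 < 100)
    exact MI.mem_arctan sc_pos hpi h (MI.mem_divPos sc_pos hQ hW hE)
  · simp at h

/-- Enclosure of `gPrim η (p/100)`, given `E ∋ η` and `piI ∋ π`. -/
def legG100 (piI E : MI) (p : ℤ) : Option MI :=
  match MI.logPos sc KL (((MI.ofFrac sc p 100).sqr sc).add (E.sqr sc)), legA100 piI E p with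
  | some L, some A =>
    some (((((MI.ofFrac sc p 100).mul sc L).divNat 2).sub (MI.ofFrac sc p 100)).add (E.mul sc A))
  | _, _ => none

/-- Soundness of `legG100`. -/
theorem mem_legG100 {η : ℝ} {piI E : MI} (hpi : MI.mem sc Real.pi piI) (hE : MI.mem sc η E)
    {p : ℤ} {G : MI} (h : legG100 piI E p = some G) :
    MI.mem sc (gPrim η ((p : ℝ) / 100)) G := by
  unfold legG100 at h
  split at h
  · rename_i L A hL hA
    simp only [Option.some.injEq] at h
    subst h
    have hW : MI.mem sc ((p : ℝ) / 100) (MI.ofFrac sc p 100) := by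
      simpa using MI.mem_ofFrac sc p (by norm_num : 0 < 100)
    have hsum := MI.mem_add (MI.mem_sqr sc_pos hW) (MI.mem_sqr sc_pos hE)
    have hlog := (MI.mem_logPos sc_pos hL hsum).2
    have hA' := mem_legA100 hpi hE hA
    have key := MI.mem_add (MI.mem_sub (MI.mem_divNat (MI.mem_mul sc_pos hW hlog)
      (by norm_num : 0 < 2)) hW) (MI.mem_mul sc_pos hE hA')
    have e : (p : ℝ) / 100 * Real.log (((p : ℝ) / 100) ^ 2 + η ^ 2) / ((2 : ℕ) : ℝ) - (p : ℝ) / 100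
        + η * Real.arctan ((p : ℝ) / 100 / η) = gPrim η ((p : ℝ) / 100) := by
      simp only [gPrim]
      push_cast
      ring
    rw [e] at key
    exact key
  · simp at h

/-- The eight legs `(p, weight)` of the second-tale profile at `ξ = −897/100` (abscissae `p/100`):
doubled numerator block `7.03, 1.47` (weight `2`), numerator block `2.03, 2.97`, denominator blocks
`(4.03 ‖ 15.03)`, `(6.03 ‖ 17.03)`. -/
def legsT : List (ℤ × ℤ) :=
  [(703, 2), (147, 2), (203, 1), (297, 1), (1503, -1), (403, 1), (1703, -1), (603, 1)]

/-- Signed sum of the angle enclosures over a list of legs. -/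
def sumA100 (piI E : MI) : List (ℤ × ℤ) → Option MI
  | [] => some ⟨0, 0⟩
  | (p, s) :: l =>
    match legA100 piI E p, sumA100 piI E l with
    | some A, some T => some (T.add (A.mulInt s))
    | _, _ => none

/-- Signed sum of the `gPrim` enclosures over a list of legs. -/
def sumG100 (piI E : MI) : List (ℤ × ℤ) → Option MI
  | [] => some ⟨0, 0⟩
  | (p, s) :: l =>
    match legG100 piI E p, sumG100 piI E l with
    | some G, some T => some (T.add (G.mulInt s))
    | _, _ => none

/-- The real signed angle sum over a list of legs (abscissae `p/100`). -/
def realA100 (η : ℝ) : List (ℤ × ℤ) → ℝ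
  | [] => 0
  | (p, s) :: l => realA100 η l + Real.arctan ((p : ℝ) / 100 / η) * s

/-- The real signed `gPrim` sum over a list of legs (abscissae `p/100`). -/
def realG100 (η : ℝ) : List (ℤ × ℤ) → ℝ
  | [] => 0
  | (p, s) :: l => realG100 η l + gPrim η ((p : ℝ) / 100) * s

/-- Soundness of `sumA100`. -/
theorem mem_sumA100 {η : ℝ} {piI E : MI} (hpi : MI.mem sc Real.pi piI) (hE : MI.mem sc η E) :
    ∀ (l : List (ℤ × ℤ)) {T : MI}, sumA100 piI E l = some T → MI.mem sc (realA100 η l) T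
  | [], T, h => by
    simp only [sumA100, Option.some.injEq] at h
    subst h
    exact mem_zero
  | (p, s) :: l, T, h => by
    simp only [sumA100] at h
    split at h
    · rename_i A T' hA hT'
      simp only [Option.some.injEq] at h
      subst h
      exact MI.mem_add (mem_sumA100 hpi hE l hT') (MI.mem_mulInt (mem_legA100 hpi hE hA) s)
    · simp at h

/-- Soundness of `sumG100`. -/
theorem mem_sumG100 {η : ℝ} {piI E : MI} (hpi : MI.mem sc Real.pi piI) (hE : MI.mem sc η E) :
    ∀ (l : List (ℤ × ℤ)) {T : MI}, sumG100 piI E l = some T → MI.mem sc (realG100 η l) T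
  | [], T, h => by
    simp only [sumG100, Option.some.injEq] at h
    subst h
    exact mem_zero
  | (p, s) :: l, T, h => by
    simp only [sumG100] at h
    split at h
    · rename_i G T' hG hT'
      simp only [Option.some.injEq] at h
      subst h
      exact MI.mem_add (mem_sumG100 hpi hE l hT') (MI.mem_mulInt (mem_legG100 hpi hE hG) s)
    · simp at h

/-- `realA100 η legsT = angleT (−897/100) η = DT η + 2π`. -/
theorem realA100_legs (η : ℝ) : realA100 η legsT = DT η + 2 * Real.pi := by
  rw [DT_eq]
  simp only [realA100, legsT, numLegsT, denAngleT1, denAngleT2]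
  push_cast
  ring

/-- `realG100 η legsT + profileTConst − 2π|η| = PT η`. -/
theorem realG100_legs (η : ℝ) :
    realG100 η legsT + profileTConst - 2 * Real.pi * |η| = PT η := by
  rw [PT_eq]
  simp only [realG100, legsT]
  push_cast
  ring

/-- Enclosure of `profileTConst = 22 log 11 − 17 log 17 − 5 log 5 + 17 log 2`. -/
def constGT : Option MI :=
  match MI.logNat2 sc KL 11, MI.logNat2 sc KL 17, MI.logNat2 sc KL 5, MI.logNat2 sc KL 2 with
  | some A, some B, some C, some D =>
    some ((((A.mulInt 22).sub (B.mulInt 17)).sub (C.mulInt 5)).add (D.mulInt 17))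
  | _, _, _, _ => none

/-- Soundness of `constGT`. -/
theorem mem_constGT {C : MI} (h : constGT = some C) : MI.mem sc profileTConst C := by
  unfold constGT at h
  split at h
  · rename_i A B C' D hA hB hC hD
    simp only [Option.some.injEq] at h
    subst h
    have key := MI.mem_add (MI.mem_sub (MI.mem_sub
      (MI.mem_mulInt (MI.mem_logNat2 sc_pos hA) 22) (MI.mem_mulInt (MI.mem_logNat2 sc_pos hB) 17))
      (MI.mem_mulInt (MI.mem_logNat2 sc_pos hC) 5)) (MI.mem_mulInt (MI.mem_logNat2 sc_pos hD) 17)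
    have e : Real.log ((11 : ℕ) : ℝ) * ((22 : ℤ) : ℝ) - Real.log ((17 : ℕ) : ℝ) * ((17 : ℤ) : ℝ)
        - Real.log ((5 : ℕ) : ℝ) * ((5 : ℤ) : ℝ) + Real.log ((2 : ℕ) : ℝ) * ((17 : ℤ) : ℝ)
        = profileTConst := by
      simp only [profileTConst]
      push_cast
      ring
    rw [e] at key
    exact key
  · simp at h

/-- `η₁ = 12914/10000 = 1.2914`. -/
def etaOneT : MI := MI.ofFrac sc 12914 10000

/-- `η₂ = 12917/10000 = 1.2917`. -/
def etaTwoT : MI := MI.ofFrac sc 12917 10000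

/-- The kernel test: `DT η₁ ≥ 0`, `DT η₂ ≤ 0`, and `PT η₁ + DT η₁ (η₂ − η₁) ≤ −29.10786`, as integer inequalities
between enclosure ends. -/
def certCheckT : Bool :=
  match MI.pi sc KA with
  | some piI =>
    match sumA100 piI etaOneT legsT, sumA100 piI etaTwoT legsT, sumG100 piI etaOneT legsT,
      constGT with
    | some A1, some A2, some G1, some C =>
      decide (2 * piI.hi ≤ A1.lo) && (decide (A2.hi ≤ 2 * piI.lo) &&
        decide (10 ^ 5 * (10000 * (G1.hi + C.hi) - 25828 * piI.lo + 3 * (A1.hi - 2 * piI.lo))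
          ≤ -(2910786 * 10000 * (sc : ℤ))))
    | _, _, _, _ => false
  | none => false

/-- The kernel test passes (kernel evaluation of the interval engine). -/
theorem certCheckT_eq : certCheckT = true := by
  decide +kernel

/-- Soundness of the kernel test. -/
theorem certCheckT_sound (h : certCheckT = true) :
    0 ≤ DT (12914 / 10000) ∧ DT (12917 / 10000) ≤ 0 ∧
      PT (12914 / 10000) + DT (12914 / 10000) * (12917 / 10000 - 12914 / 10000) ≤ -29.10786 := by
  unfold certCheckT at h
  split at h
  · rename_i piI hpiI
    split at h
    · rename_i A1 A2 G1 C hA1 hA2 hG1 hC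
      simp only [Bool.and_eq_true, decide_eq_true_eq] at h
      obtain ⟨i1, i2, i3⟩ := h
      have hS : (0 : ℝ) < sc := by exact_mod_cast sc_pos
      have hpi := MI.mem_pi sc hpiI
      have hE1 : MI.mem sc (12914 / 10000 : ℝ) etaOneT := by
        simpa [etaOneT] using MI.mem_ofFrac sc 12914 (by norm_num : 0 < 10000)
      have hE2 : MI.mem sc (12917 / 10000 : ℝ) etaTwoT := by
        simpa [etaTwoT] using MI.mem_ofFrac sc 12917 (by norm_num : 0 < 10000)
      have mA1 := mem_sumA100 hpi hE1 legsT hA1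
      have mA2 := mem_sumA100 hpi hE2 legsT hA2
      have mG1 := mem_sumG100 hpi hE1 legsT hG1
      have mC := mem_constGT hC
      rw [realA100_legs] at mA1 mA2
      have c1 : (2 : ℝ) * piI.hi ≤ A1.lo := by exact_mod_cast i1
      have c2 : (A2.hi : ℝ) ≤ 2 * piI.lo := by exact_mod_cast i2
      have c3 : (10 : ℝ) ^ 5 * (10000 * ((G1.hi : ℝ) + C.hi) - 25828 * piI.lo
          + 3 * (A1.hi - 2 * piI.lo)) ≤ -(2910786 * 10000 * (sc : ℝ)) := by
        exact_mod_cast i3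
      have eP := realG100_legs (12914 / 10000 : ℝ)
      rw [abs_of_pos (by norm_num : (0 : ℝ) < 12914 / 10000)] at eP
      unfold MI.mem at hpi mA1 mA2 mG1 mC
      refine ⟨?_, ?_, ?_⟩
      · have key : (2 * Real.pi) * sc ≤ (DT (12914 / 10000) + 2 * Real.pi) * sc := by
          linarith [hpi.2, mA1.1]
        nlinarith [le_of_mul_le_mul_right key hS]
      · have key : (DT (12917 / 10000) + 2 * Real.pi) * sc ≤ (2 * Real.pi) * sc := by
          linarith [hpi.1, mA2.2]
        nlinarith [le_of_mul_le_mul_right key hS]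
      · rw [← eP]
        have hD : DT (12914 / 10000) * sc ≤ (A1.hi : ℝ) - 2 * piI.lo := by
          have := mA1.2
          linarith [hpi.1]
        have key : (realG100 (12914 / 10000) legsT + profileTConst - 2 * Real.pi * (12914 / 10000)
            + DT (12914 / 10000) * (12917 / 10000 - 12914 / 10000)) * sc
            ≤ (-29.10786 : ℝ) * sc := by
          nlinarith [mG1.2, mC.2, hpi.1, hD]
        exact le_of_mul_le_mul_right key hS
    · simp at h
  · simp at h

/-- **The certificate**: `profileT (−897/100) η ≤ −29.10786` for every `η > 0`. -/
theorem profileT_le_of_pos {η : ℝ} (hη : 0 < η) : profileT (-897 / 100) η ≤ -29.10786 := by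
  obtain ⟨hD1, hD2, hP⟩ := certCheckT_sound certCheckT_eq
  have h := twoPoint (by norm_num) (by norm_num) (by norm_num) hD1 hD2 hη
  exact h.trans hP

/-- `profileT (−897/100) η ≤ −29.10786` for every `η ≠ 0` (evenness). -/
theorem profileT_le {η : ℝ} (hη : η ≠ 0) : profileT (-897 / 100) η ≤ -29.10786 := by
  rcases lt_or_gt_of_ne hη with h | h
  · rw [← profileT_neg_eta]
    exact profileT_le_of_pos (neg_pos.2 h)
  · exact profileT_le_of_pos h

/-! ## The certificate with slack -/

/-- On `η > 0`: `profileT0 (−897/100) η − (2π − δ) η ≤ −29.10786 + 7 δ` for `0 ≤ δ ≤ 3`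
(concavity up to `η = 7`, the tail slope `PT_tail` beyond). -/
theorem certT_of_pos {δ : ℝ} (hδ0 : 0 ≤ δ) (hδ3 : δ ≤ 3) {η : ℝ} (hη : 0 < η) :
    profileT0 (-897 / 100) η - (2 * π - δ) * η ≤ -29.10786 + 7 * δ := by
  have hP : profileT0 (-897 / 100) η - (2 * π - δ) * η = PT η + δ * η := by
    simp only [PT, profileT, abs_of_pos hη]
    ring
  rw [hP]
  rcases le_or_gt η 7 with h7 | h7
  · have h1 : PT η ≤ -29.10786 := profileT_le_of_pos hη
    nlinarith
  · have ht := PT_tail h7.le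
    have h7v : PT 7 ≤ -29.10786 := profileT_le_of_pos (by norm_num)
    nlinarith

/-- **The `δ`-certificate**: for `0 ≤ δ ≤ 3` and every `η ≠ 0`,
`profileT0 (−897/100) η − (2π − δ)|η| ≤ −29.10786 + 7 δ`. -/
theorem certT_delta {δ : ℝ} (hδ0 : 0 ≤ δ) (hδ3 : δ ≤ 3) (η : ℝ) (hη : η ≠ 0) :
    profileT0 (-897 / 100) η - (2 * π - δ) * |η| ≤ -29.10786 + 7 * δ := by
  rcases lt_or_gt_of_ne hη with h | h
  · have h' : 0 < -η := by linarith
    have hc := certT_of_pos hδ0 hδ3 h'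
    rw [profileT0_neg_eta] at hc
    rw [abs_of_neg h]
    linarith
  · rw [abs_of_pos h]
    exact certT_of_pos hδ0 hδ3 h

end Summit.KontsevichZagierPeriods.Zeta5Search.TwoTaleP15SecondLineCertificate

end
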